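import Literature.Analysis.FluidPDE.LocalEnergySolutionsOn
import Literature.Analysis.FluidPDE.MildSolution
import HarnessLib

/-!
# Global weak `L³`-solutions (Seregin–Šverák 2017, Thm. 1.6) — RETIRED named fact

Analysis/FluidPDE documentation module (one elementary lemma, no definitions, no named facts).
Until the D-0026 review of 2026-08-15 this file vendored ONE named fact,

`Literature.Analysis.FluidPDE.sereginSverak2017_weakL3_exists`

— Seregin–Šverák, *On global weak solutions to the Cauchy problem for the Navier–Stokes
equations with large `L₃`-initial data*, Nonlinear Anal. 154 (2017) 269–296 = arXiv:1601.03096,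
**Thm. 1.6** read through **Def. 1.3** and **Remarks 1.4–1.5** (arXiv pp. 3–4): for every
`M > 0` a constant `c = c(M)` such that every weakly divergence-free `v₀ ∈ L³(ℝ³)` with
`‖v₀‖₃ ≤ M` is the datum of a pair `(v, q)` on `ℝ³ × (0, ∞)` which is a local energy solution in
Seregin's class `IsLocalEnergySolutionOn T 1 v₀ v q` for every `T > 0`, whose layer
`v(t) − e^{tΔ}v₀` lies in `L²(ℝ³)` with `∫ |v(t) − e^{tΔ}v₀|² ≤ c√t` for every `t ≥ 0`, and whose
layer has a weak spatial gradient `G₂` on `(0, ∞) × ℝ³` with `∫₀ᵀ∫ |G₂|²_F ≤ c√T` for every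
`T > 0` — as the decomposition child of `lemarieRieusset_prop_15_1` (`NSSereginMildFacts.lean`;
Lemarié-Rieusset 2016, Prop. 15.1), with the proved glue
`lemarieRieusset_prop_15_1_of_sereginSverak2017` in `NSSereginMildProp151.lean`.

## Why it was retired (review with the source open)

* *Faithful, but not a cut.* The transcription is faithful to the printed statements (Def. 1.3,
  Remark 1.4 "`|v²|²_{2,Q_T} ≤ c(M)√T`" for every `T`, proof of Prop. 2.4; Remark 1.5; Thm. 1.6),
  and Thm. 1.6 is a theorem, not an open problem. But its proof (arXiv:1601.03096, §2, pp. 5–10)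
  is an existence *theory*: Leray–Schauder fixed points for the linearised and the mollified
  perturbed systems on balls `B(R)` (Props. 2.1–2.2), the exhaustion `R → ∞` with the energy
  bound `c(‖v₀‖₃)√T` (Prop. 2.4), Solonnikov's coercive `L_{s,l}` estimates for four pressure
  pieces, the limit `ρ → 0`, the local and the global energy inequalities. None of these tools is
  in Mathlib or proved in the tree; the fact is of the same size as its parent Prop. 15.1
  (Lemarié-Rieusset 2016, pp. 560–564), i.e. the parent's whole difficulty in another author's
  formulation, not an `M`-sized child (D-0026).
* *Duplicate debt.* The existence content is already carried, with its own seats, by the named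
  facts `localEnergySolution_exists_local_of_memE2` / `localEnergySolution_extension_of_memE2`
  (`LocalEnergyExtension.lean`; Seregin 2014, App. B, Prop. 1.8 and §B.5 = Lemarié-Rieusset
  2016, Thms. 14.1, 14.8), from which `localLeraySolution_exists_of_memE2` (Thm. 14.8) is proved;
  the uniform bounds and the uniform layer of Prop. 15.1 are Jia–Šverák 2013, Cor. 1 and Lemma 8
  (`jia_sverak_2013_corollary_1`, `jia_sverak_2013_lemma_8`, `JiaSverak2013Compactness.lean`).
  `NSSereginMildProp151.lean` now proves
  `lemarieRieusset_prop_15_1_of_facts : F1 → F2 → Cor. 1 → Lemma 8 → lemarieRieusset_prop_15_1`,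
  so nothing downstream needs the Seregin–Šverák statement, and keeping it would leave a third,
  `XL`, rendering of one existence theorem on the debt ledger.
* *What is not lost.* The global-energy form of the layer (Remark 1.4: `v − e^{tΔ}v₀` in
  `L_{2,∞} ∩ W^{1,0}_2(Q_T)` with the `√T` rate) is genuinely more than Prop. 15.1 uses (unit
  balls); should a consumer ever need it, the statement above is the one to re-vendor, through
  the split path and together with a proof plan (e.g. from Calderón's splitting and a perturbed
  Leray–Hopf theory), not as a hypothesis-position fact.

## References

* G. Seregin, V. Šverák, Nonlinear Anal. 154 (2017) 269–296 = arXiv:1601.03096: Def. 1.2,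
  Def. 1.3, Remarks 1.4–1.5, Thm. 1.6 (pp. 3–4); §2, Props. 2.1, 2.2, 2.4 and the limit
  `ρ → 0` (pp. 5–10) [SereginSverak2017].
* P. G. Lemarié-Rieusset, *The Navier–Stokes Problem in the 21st Century* (2016), Prop. 15.1
  (PDF p. 559, proof pp. 560–564), Thm. 14.1, Thm. 14.8 [LemarieRieusset2016].
* H. Jia, V. Šverák, SIAM J. Math. Anal. 45 (2013) = arXiv:1201.1592, Cor. 1, Lemma 8
  [JiaSverak2013].
* G. Seregin, *Lecture notes on regularity theory for the Navier–Stokes equations* (2014),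
  App. B, Def. B.1, Prop. 1.8, §B.5 [Seregin2014Notes].
-/

noncomputable section

open MeasureTheory Set
open scoped ENNReal NNReal

namespace Literature.Analysis.FluidPDE

/-- **A global `L²` layer bound gives the uniformly local one** — the step by which the retired
route fed Prop. 15.1 (Seregin–Šverák's Remark 1.4, `∫ |v(t) − e^{tΔ}v₀|² ≤ c√t` on the whole
space, implies Lemarié-Rieusset's `‖v(t) − e^{tΔ}v₀‖_{L²(B(x₀,1))} ≤ (c√t)^{1/2}`): if
`∫ ‖f‖² ≤ b` then `‖f‖_{L²(s)} ≤ √b` for every set `s`. [folklore] -/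
theorem eLpNorm_two_restrict_le_sqrt_of_lintegral_le {α F : Type*} [MeasurableSpace α]
    [NormedAddCommGroup F] {μ : Measure α} {f : α → F} {b : ℝ} (hb : 0 ≤ b)
    (h : ∫⁻ x, ‖f x‖ₑ ^ 2 ∂μ ≤ ENNReal.ofReal b) (s : Set α) :
    eLpNorm f 2 (μ.restrict s) ≤ ENNReal.ofReal (Real.sqrt b) := by
  refine (eLpNorm_mono_measure f Measure.restrict_le_self).trans ?_
  rw [eLpNorm_eq_lintegral_rpow_enorm_toReal two_ne_zero ENNReal.ofNat_ne_top, ENNReal.toReal_ofNat,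
    Real.sqrt_eq_rpow, ← ENNReal.ofReal_rpow_of_nonneg hb (by norm_num : (0 : ℝ) ≤ 1 / 2)]
  have e : ∫⁻ x, ‖f x‖ₑ ^ (2 : ℝ) ∂μ = ∫⁻ x, ‖f x‖ₑ ^ 2 ∂μ :=
    lintegral_congr fun x => by rw [← ENNReal.rpow_natCast]; norm_num
  rw [e]
  exact ENNReal.rpow_le_rpow h (by norm_num)

end Literature.Analysis.FluidPDE

end
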